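import Summits.QuantumFields.BalabanUV.T4Continuum.Support.NE7OneStepOfRoutePi
import HarnessLib

/-!
# NE7RoutePiRegimeSU2 — THE W6 REGIME OF ROW NE3's RIGHT INVERSE IS AUTOMATIC AT `d = 4`, `L = 2`, `ε ≤ 10⁻⁵³`: `thetaLoc 4 2 < 10¹⁹`, hence
# `thetaLoc 4 2·ε < 1`; the END of record of generation 69 WITHOUT the regime hypothesis

Cell `pub-balaban`, rung (B)+1 sub-cell t4, lineage `b2b-balaban-t4-ne7-p1`, generation 69 (CRUX PROVER NE7 #1); memo
`t4/b2b-balaban-t4-ne7-p1-g69/HUNT-H13-ROUTE-PI-TRANSPOSED.md` §4.  File F33 (over F31 `NE7OneStepOfRoutePi.oneStep_SU2_of_dataClass_ape_routePi`).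
WHAT ([folklore] closed-term arithmetic; 0 def, 0 sorry).  Row NE3's constants are closed rational terms of `(d, L)`: `nbRad 4 2 = 20`, `baseShift 4 2 = 25`,
`regC 4 2 = 129`, `Csup 4 2 = 27568`, `liftC 4 = 12288`, `rhoC 4 2 = 75308176∕3`, `cruxC 4 2 = 308493991936` (≈ `3.08·10¹¹`),
`thetaLoc 4 2 = cruxC 4 2 · 23059205 < 10¹⁹`.  §1 the evaluations; §2 **`oneStep_SU2_of_dataClass_ape_routePi'`** — F31's END with `hθl` DISCHARGED
(`ε ≤ 10⁻⁵³`).  After this file the uniform hypotheses of the END of record are: the ceilings `α̂ ≤ 1`, `Ĉ`, `C₂`, the definitions of `ν̂`, `κ̂`, and the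
two k-free lines `ν̂ < 1`, the strict CONV line — conditions among the supplier's currencies only.
HONEST FRAMING (page 1): arithmetic; nothing of Bałaban's asserted; (APE), Π-L1♮, the quadratic letter NOT proved; NOT ONE-STEP, NOT NE7; spine 0∕9; finite
T⁴ rung (B)+1 — NOT infinite volume, NOT mass gap, NOT Clay.  Continuum YM on T⁴ ⇐ BetaPertH ∧ nine spine estimates (0/9 proved); BetaPertH ⇐ (D1) ∧ (D4)
∧ CAP+tail; G-an2-4 gates asym, D1 and NE2/3/4.
-/

set_option autoImplicit false

open scoped BigOperators Matrix Matrix.Norms.L2Operator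
open NormedSpace Finset Set

namespace Summit.QuantumFields.BalabanUV.T4Continuum.NE7RoutePiRegimeSU2

open Literature.MathematicalPhysics.QuantumFieldTheory.Balaban1983to89
open B7Prop1Explicit B7Prop2Explicit
open T4AveragingDeficitWall (IsUnitaryCfg IsSkewDir SmallField vary curl curlSq dirSq dirL1)
open T4AveragingDeficitWallBoundary (IsPeriodicCfg periodBox)
open AveragingDeficitPeriodicCounting (IsPeriodicDir)
open AveragingDeficitMultiLevelPrep (LevelSmall tower TangentIter)
open MinimalActionLevels (perWin)
open MinimalActionSandwich (IsMinimiser admissible)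
open MinimalActionRate (sfClass)
open NE3HessForm (dAction)
open NE3SlicePoincareBudgetLine (CPLine)
open NE3FrameFreeSliceW (frameFreeBlockLandauW)
open NE3TangentCovariantTower (dirIter)
open NE3DecomposedRepOfLinearNormalPart (ResidualSliceRepT)
open NE3QbarIterCovLiftPrep (cruxC liftC regC rhoC baseShift)
open NE3CovariantLineSumsError (Csup)
open BlockAverageVaryHolo (nbRad)
open NE3SmoothRightInverseW (rightInvW)
open NE3RightInverseSolveLetters (thetaLoc)
open NE3RightInverseL2Letter (l2C)
open NE3HatInvCurlLetters (curl2C curl1C)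
open NE3EnergyWeightedShapes (energyNormW)
open NE3EnergyShapes (IsUnitarySite)
open NE7OneStepOfRoutePi (oneStep_SU2_of_dataClass_ape_routePi)

noncomputable section

/-! ## §1 The closed terms at `d = 4`, `L = 2` -/

/-- `nbRad 4 2 = 20`. [folklore] -/
theorem nbRad_4_2 : nbRad 4 2 = 20 := by unfold nbRad; norm_num

/-- `regC 4 2 = 129`. [folklore] -/
theorem regC_4_2 : regC 4 2 = 129 := by
  unfold regC baseShift; rw [nbRad_4_2]; norm_num

/-- `Csup 4 2 = 27568`. [folklore] -/
theorem Csup_4_2 : Csup 4 2 = 27568 := by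
  unfold Csup; rw [nbRad_4_2]; norm_num

/-- `liftC 4 = 12288`. [folklore] -/
theorem liftC_4 : liftC 4 = 12288 := by unfold liftC; norm_num

/-- `rhoC 4 2 = 75308176 ∕ 3`. [folklore] -/
theorem rhoC_4_2 : rhoC 4 2 = 75308176 / 3 := by
  unfold rhoC; rw [regC_4_2, Csup_4_2]; norm_num

/-- `cruxC 4 2 = 308493991936`. [folklore] -/
theorem cruxC_4_2 : cruxC 4 2 = 308493991936 := by
  unfold cruxC; rw [liftC_4, regC_4_2, rhoC_4_2]; norm_num

/-- `thetaLoc 4 2 = 308493991936 · 23059205 < 10¹⁹`. [folklore] -/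
theorem thetaLoc_4_2_lt : thetaLoc 4 2 < 10 ^ 19 := by
  unfold thetaLoc; rw [cruxC_4_2, nbRad_4_2]; norm_num

/-- **THE W6 REGIME AT `d = 4`, `L = 2`**: `ε ≤ 10⁻⁵³ ⟹ thetaLoc 4 2·ε < 1`. [folklore] -/
theorem thetaLoc_mul_lt_one {ε : ℝ} (hε : 0 < ε) (hε' : ε ≤ 1 / 10 ^ 53) : thetaLoc 4 2 * ε < 1 := by
  have h := thetaLoc_4_2_lt
  have h1 : thetaLoc 4 2 * ε ≤ thetaLoc 4 2 * (1 / 10 ^ 53) := by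
    have h0 : 0 ≤ thetaLoc 4 2 := by
      unfold thetaLoc; have := NE3RightInverseSolveLetters.cruxC_nonneg 4 2; positivity
    exact mul_le_mul_of_nonneg_left hε' h0
  have h2 : thetaLoc 4 2 * (1 / 10 ^ 53) < 10 ^ 19 * (1 / 10 ^ 53) := mul_lt_mul_of_pos_right h (by norm_num)
  have h3 : (10 : ℝ) ^ 19 * (1 / 10 ^ 53) ≤ 1 := by norm_num
  linarith

variable {n : Type*} [Fintype n] [DecidableEq n]

/-! ## §2 The END of record without the regime hypothesis -/

/-- **ONE-STEP AT `d = 4`, `L = 2`, SU(2)∕U(2), `0 < ε ≤ 10⁻⁵³`, FOR ALL `γ`-SMALL DATA ⇐ (APE) ∧ ROW NE3's `hleaves` ON `𝒟_β`** — F31's END of record with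
the W6 regime `thetaLoc 4 2·ε < 1` DISCHARGED (§1).  Displayed uniform hypotheses: the ceilings and the two k-free lines only. [folklore] -/
theorem oneStep_SU2_of_dataClass_ape_routePi' [Nonempty n] (hn : Fintype.card n = 2) {N : ℕ} [NeZero N] (hN : 1 ≤ N) {ε δ δ₁ β : ℝ}
    (hε : 0 < ε) (hε' : ε ≤ 1 / 10 ^ 53) (hδ₁ : 0 ≤ δ₁) (hδ₁δ : δ₁ < δ) (hδε : δ < ε) (hβ : 0 < β)
    {C₂ αh Ch : ℝ} (hC₂ : 0 ≤ C₂) (hαh0 : 0 ≤ αh) (hαh1 : αh ≤ 1) (hCh0 : 0 ≤ Ch)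
    {νh κh : ℝ} (hνh : νh = 2 * Real.sqrt (l2C 4 2 / (1 - thetaLoc 4 2 * ε) ^ 2 + curl2C 4 2 / (1 - thetaLoc 4 2 * ε) ^ 2) * C₂ * Ch * αh)
    (hκh : κh = 4 * (curl1C 4 2 / (1 - thetaLoc 4 2 * ε)) * C₂ * Ch ^ 2 * ε) (hν : νh < 1)
    (hline : 2 * (κh / (1 - νh) ^ 2) < ((((1 / 2 - (νh / (1 - νh)) ^ 2) / (2 * (1 + (CPLine 4 2 2 (1 / 10 ^ 17) (1 / 10 ^ 53) + 1)))
        - (νh / (1 - νh)) ^ 2) / 2 - 576 * (4 : ℕ) * (αh ^ 2 * Real.exp (2 * αh))) / (Fintype.card n : ℝ) - 28 * (4 : ℕ) * (ε + 7 * αh ^ 2)))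
    (hape : ∀ D : Site 4 → Fin 4 → (Matrix n n ℂ)ˣ, IsUnitaryCfg D → IsPeriodicCfg D (N : ℤ) → SmallField D (4 * (Real.exp β - 1)) →
      ∀ (k : ℕ), ∀ U ∈ admissible (sfClass 4 2 N ε) 2 (k + 1) D, SmallField U (δ / ((((2 : ℕ) : ℝ)) ^ (k + 1)) ^ 2) →
      (∀ φ : Site 4 → Fin 4 → Matrix n n ℂ, IsSkewDir φ → IsPeriodicDir φ ((N * 2 ^ (k + 1) : ℕ) : ℤ) → TangentIter 2 k U φ →
        dAction U φ (perWin 4 (N * 2 ^ (k + 1))) = 0) → SmallField U (δ₁ / ((((2 : ℕ) : ℝ)) ^ (k + 1)) ^ 2))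
    (hleaves : ∀ D : Site 4 → Fin 4 → (Matrix n n ℂ)ˣ, IsUnitaryCfg D → IsPeriodicCfg D (N : ℤ) → SmallField D (4 * (Real.exp β - 1)) →
      ∀ (k : ℕ), ∀ Us ∈ admissible (sfClass 4 2 N ε) 2 (k + 1) D, SmallField Us (δ₁ / ((((2 : ℕ) : ℝ)) ^ (k + 1)) ^ 2) →
      (∀ φ : Site 4 → Fin 4 → Matrix n n ℂ, IsSkewDir φ → IsPeriodicDir φ ((N * 2 ^ (k + 1) : ℕ) : ℤ) → TangentIter 2 k Us φ →
        dAction Us φ (perWin 4 (N * 2 ^ (k + 1))) = 0) →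
      ∀ U' ∈ admissible (sfClass 4 2 N ε) 2 (k + 1) D,
      ∃ (u : Site 4 → (Matrix n n ℂ)ˣ) (X₀ : Site 4 → Fin 4 → Matrix n n ℂ) (α₀ : ℝ) (m : Site 4 → Fin 4 → ℝ) (C : ℝ),
        IsSkewDir X₀ ∧
        (∀ (hWu : IsUnitaryCfg Us) (hx : 0 ≤ ε / ((((2 : ℕ) : ℝ)) ^ (k + 1)) ^ 2)
            (hs : LevelSmall 4 2 k (ε / ((((2 : ℕ) : ℝ)) ^ (k + 1)) ^ 2)) (hWx : SmallField Us (ε / ((((2 : ℕ) : ℝ)) ^ (k + 1)) ^ 2))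
            (hθ : cruxC 4 2 * (((((2 : ℕ) : ℝ)) ^ (k + 1)) ^ 2 * (ε / ((((2 : ℕ) : ℝ)) ^ (k + 1)) ^ 2)) < 1)
            (hφ : IsSkewDir (dirIter 2 (k + 1) Us X₀)),
          ResidualSliceRepT 2 N (k + 1) Us U' u X₀ (rightInvW (by norm_num) k hWu hx hs hWx N hθ hφ) α₀) ∧
        (∀ z κ, 0 ≤ m z κ) ∧ 0 ≤ C ∧
        ((((2 : ℕ) : ℝ)) ^ (k + 1)) ^ 4 * ∑ z ∈ periodBox (d := 4) N, ∑ κ : Fin 4, m z κ ^ 2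
          ≤ C ^ 2 * dirSq X₀ (periodBox (d := 4) (N * 2 ^ (k + 1))) ∧
        (∀ z ∈ periodBox (d := 4) N, ∀ κ : Fin 4, ‖dirIter 2 (k + 1) Us X₀ z κ‖ ≤ C₂ * ((((2 : ℕ) : ℝ)) ^ (k + 1) * m z κ) ^ 2) ∧
        α₀ * (((2 : ℕ) : ℝ)) ^ (k + 1) ≤ αh ∧ (∀ z κ, m z κ * (((2 : ℕ) : ℝ)) ^ (k + 1) ≤ αh) ∧ C ≤ Ch) :
    ∃ γ : ℝ, 0 < γ ∧ ∀ V : Site 4 → Fin 4 → (Matrix n n ℂ)ˣ, IsUnitaryCfg V → IsPeriodicCfg V (N : ℤ) → SmallField V γ →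
      ∀ (k : ℕ) (U₀ : Site 4 → Fin 4 → (Matrix n n ℂ)ˣ), U₀ ∈ admissible (sfClass 4 2 N ε) 2 (k + 1) V →
        SmallField U₀ (δ / ((((2 : ℕ) : ℝ)) ^ k) ^ 2) →
        ∃ U, IsMinimiser 4 (sfClass 4 2 N ε) 2 N (k + 1) V U ∧ SmallField U (δ / ((((2 : ℕ) : ℝ)) ^ (k + 1)) ^ 2) :=
  oneStep_SU2_of_dataClass_ape_routePi hn hN hε hε' hδ₁ hδ₁δ hδε hβ (thetaLoc_mul_lt_one hε hε') hC₂ hαh0 hαh1 hCh0 hνh hκh hν hline hape hleaves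

end

end Summit.QuantumFields.BalabanUV.T4Continuum.NE7RoutePiRegimeSU2
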